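import Mathlib
import HarnessLib
import Literature.MathematicalPhysics.StatisticalMechanics.LennardJonesClusters
import Literature.MathematicalPhysics.StatisticalMechanics.LennardJonesThermodynamicLimitProofs
import Summits.AtomisticToContinuum.Crystallization.Theorems.LoopTunnelDialLocalSurgery
import Summits.AtomisticToContinuum.Crystallization.Theorems.LoopTunnelDialOrderOneRung
import Summits.AtomisticToContinuum.Crystallization.Theorems.LoopTunnelDialVoidRung
import Summits.AtomisticToContinuum.Crystallization.Theorems.LoopTunnelDialVoidRungCredit
import Summits.AtomisticToContinuum.Crystallization.Theorems.LoopTunnelDialRangeTails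

/-!
(Landing split for the 400-line lint: this module = §1–§2b; §3–§6 = `LoopTunnelDialCalibratorRungSeats`.)
# LoopTunnelDial — the CALIBRATOR RUNG of the NEAR floor on crux `PocketCase` (stmt-AtomisticToContinuum-27294):
the chemical potential is ELIMINATED by the loosest particle; voids of EVERY thickness are priced

decomp-a2c lens-5 «finite/base range + asymptotic regime + bridge», generation 24; `--supports stmt-AtomisticToContinuum-27294
--as helper`.  Sorry-free, NO new definitions (D-0009: every texture is written UNFOLDED over Literature's `interactionEnergy` /
`siteEnergy` / `lennardJones` / `groundStateEnergy`; the line file recovers `MuStable` / `Improvable` / `FloorEvI` / `RigidNearPocket0`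
on a class by `Iff.rfl`), imports only landed modules (`LoopTunnelDialLocalSurgery`, `…OrderOneRung`, `…VoidRung`, `…VoidRungCredit`, `…RangeTails`).

THE LOCATED RESIDUAL IT ANSWERS (generation 23, critic row 332 (3)).  The landed void rungs (`LoopTunnelDialVoidRung`: caged voids;
the credited-void certificate of the g23 line) price the filling of a `k`-void against the LEVEL FLOOR `−B`, `B = 0.78647722` (the two-cone
bound, the only certified lower bound on the limit level `e = lim E(N)/N` in the tree).  Their reach ends at THICK SEALED CAVITIES: the filling
gain of a cavity of `k` sites in a host of site energy `2e_loc` is `|e_loc|·k + s` (`s` = the cavity's surface energy, surface-order) while the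
requirement is `B·k + η` — the slack `(B − |e_loc|)·k ≈ 0.069·k` is volume-order.  The obstruction is NOT a surface-energy asymptotic; it is that
`e` is unknown from below.

THE MOVE (new in the lineage): ELIMINATE `e` instead of bounding it.  μ-stability of order `j` at level `e` with tolerance `ε` contains
TWO inequalities at the SAME `e`:
* removal of ANY particle `m`:            `𝓔^m(y) ≤ e + ε`                                    (order one, landed `kinkBalanced_of_muStable`);
* insertion of ANY `k ≤ j` holes `q`:     `−(𝓔(q) + Σ_i Σ_l V(|q_i − y_l|)) ≤ −e·k + ε`       (order `k`, Literature `interactionEnergy_append`).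
Multiplying the first by `k` and adding:

  ★ CALIBRATED VOID LAW (`fillGain_le_of_muStable`, PROVED, GS-free, LEVEL-FREE):  at an `(e, ε, j)`-μ-stable injective `y`, for EVERY
    particle `m` and EVERY hole family `q : Fin k → E3` (`1 ≤ k ≤ j`, injective, off the particles),
        `fillGain(q, y) := −(𝓔(q) + Σ_i Σ_l V(|q_i − y_l|)) ≤ k·(ε − 𝓔^m(y)) + ε`.
    «No void can be filled at a per-particle gain exceeding the binding of the loosest particle» — Kossel's half-crystal rule of order `k`.
    The level `e` has disappeared: the loosest particle of the configuration CALIBRATES the reservoir.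

  ★★ (`filledSites_ge_of_muStable`, PROVED): with the SURFACE FLOOR of §1 (`e·k + 1/12 ≤ E(k)`, from the thermodynamic limit by name:
    Literature `BlancLewin2015_8_holds`, and this file's DOCKING inequality `E(K+M) ≤ E(K) + E(M) − 1/12`), the filled sites of `q ⧺ y` satisfy
        `Σ_i 𝓔^{q_i}(q ⧺ y) ≥ k·(2𝓔^m(y) − 2ε) + (1/12 − ε)`:
    «after filling, the mean binding of the filled sites is at most TWICE the binding of the loosest original particle (+ tolerances)».

CONSEQUENCES (the rung, both currencies of the line).
* `improvable_of_calibratedVoid` (§3, configuration-wise, EVERY level `e`): a «CALIBRATED VOID within `R` of `y c`» — hole points `q : Fin k → E3`,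
  `1 ≤ k ≤ ⌈64R³⌉`, within `R` of `y c`, `9/10`-clear of all particles, pairwise `9/10` apart, and a particle `m` (ANYWHERE) with
        `k·(1/100 − 𝓔^m(y)) + 1/50 ≤ fillGain(q, y)`
  — makes `y` radius-`R` improvable by `1/100` at level `e` about SOME particle (about `m` by deletion if `𝓔^m(y) ≥ e + 1/100`, else about `c`
  by filling); `calibrator_floor` (§3, sequence level) is LITERALLY the line's `FloorEvI x trig` conclusion `∃ c, Improvable e (1/100) R (x N) c`
  for the sub-trigger «calibrated void within `R` of some particle», at every index and EVERY level: NEAR♯ restricted to near pockets carrying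
  a calibrated void is thereby PROVED, with no level floor.
* `fillGain_lt_of_muStable` / `rigid_calibratedVoid_seat` (§4, μ-seat currency = `RigidNearPocket0` on the class): an `(e, 1/(j+1), j)`-μ-stable
  configuration, `j ≥ max ⌈64R³⌉ 100`, ANY `e`, carries NO calibrated void within `R` of any particle — at every index, not only eventually.
* `calibrated_of_caged` / `calibrated_of_credited` (§5): a caged void (`20k ≤ 2P + D`, landed `LoopTunnelDialVoidRung`) resp. a credited void
  (`2(B·k + 1/100) ≤ 2P_w + D_w`, landed `LoopTunnelDialVoidRungCredit`) IS a calibrated void as soon as some particle binds by at most `0.77`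
  resp. `B − 1/50 = 0.766`; the new class extends the landed reach, it does not sit beside it.
* §2b THE SAME LAW FOR GROUND STATES FROM THE STAIRCASE ALONE (`fillGain_le_increments`, `fillGain_le_of_staircase`, PROVED): at a ground state on
  `N` particles `fillGain(q, y) ≤ E(N) − E(N + k)`; hence with ANY removal bound `𝓔^m(y) ≤ Δ` (the landed `siteEnergy_le_increment`: `Δ = E(N) − E(N−1)`)
  the calibrated law holds with tolerance `δ = k·Δ − (E(N+k) − E(N))` — the `k`-step CONCAVITY EXCESS of the number sequence `E(·)` at `N` is the
  only input μ-stability contributes (census instrument I-STAIR: tabulate it from the known `E(N)`).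
* §6 WHERE CALIBRATORS LIVE (Kossel's half-environment principle, PROVED, GS-free): `exists_antipodalFree` — every nonempty injective
  configuration has a particle (a farthest one from the origin) no two of whose neighbour vectors are antipodal; `half_le_siteEnergy_of_antipodalFree`
  — a particle whose neighbour vectors form an antipodal-free part of a centrosymmetric set `T` (all `|v| ≥ 9/10`) binds at most HALF of `T`'s
  centre: `(1/2)·Σ_{v ∈ T} V(|v|) ≤ 𝓔^m(y)`; `half_sub_tail_le_siteEnergy_of_antipodalFree_near` — the same at finite range `ρ` up to the landed
  energy tail `tailE ρ` (`LoopTunnelDialRangeTails`).  A convex-hull vertex of a host-lattice-like surface patch is therefore a calibrator for every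
  void whose mean filling gain per hole exceeds `|e_loc| + 1/100 + 1/(50k)` (+ tail) — every sealed cavity of the host, of every thickness (mean gain
  `|e_loc| + s/k` with `s` of surface order `∼ k^{2/3}`, against a requirement of `k/100 + 1/50`).

CERTIFIED REACH / LOCATED RESIDUAL (stated, not claimed beyond): the thick-sealed-cavity class of generation 23 (≥ 3 missing layers, 87- and 177-site balls,
3-layer discs from `k ≈ 97`) is priced at order `j = max(k, 100)` whenever ONE particle of the finite cluster binds by at most the host's
half-crystal value `|e_loc|` (free-surface vertices, kink and step-end atoms on host-lattice positions: §6).  What survives μ-rigidity with a sealed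
cavity is a cluster ALL of whose particles — every convex-hull vertex included — bind by MORE than the cavity host's `|e_loc| + s/k − 1/100`:
a free surface entirely reconstructed into over-binding non-host motifs (tetrahedral frustration AT THE SURFACE), next to the zero-signature
planar faults and strained matter already located.  The volume defect has been traded for a surface statement; no surface-energy asymptotic
and no bound on `e⋆` is used anywhere.

§1 docking and the surface floor · §2 the two laws · §2b the staircase form for ground states · §3 calibrated voids are local improvements
(NEAR♯ currency) · §4 the μ-seat · §5 caged / credited ⟹ calibrated · §6 where calibrators live.
-/

open scoped BigOperators Classical Topology
open Filter
open Literature.MathematicalPhysics.StatisticalMechanics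
open Summit.AtomisticToContinuum.Crystallization.Theorems.GrainPercolationDialCrossCeiling (E3)
open Summit.AtomisticToContinuum.Crystallization.Theorems.LoopTunnelDialLocalSurgery
open Summit.AtomisticToContinuum.Crystallization.Theorems.LoopTunnelDialVoidRung
open Summit.AtomisticToContinuum.Crystallization.Theorems.LoopTunnelDialVoidRungCredit (two_mul_interactionEnergy_le_neg_credit
  cross_le_neg_credit)
open Summit.AtomisticToContinuum.Crystallization.Theorems.LoopTunnelDialRangeTails (farIdx nearIdx tailE sum_erase_eq_near_add_far
  sum_far_abs_lennardJones_le)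

namespace Summit.AtomisticToContinuum.Crystallization.Theorems.LoopTunnelDialCalibratorRung

variable {N : ℕ}

/-! ## §1 Docking and the surface floor -/

/-- **DOCKING (PROVED, GS-free, quantitative form of Literature's `groundStateEnergy_add_lt`):** `E(K + M) ≤ E(K) + E(M) − 1/12` for
`K, M ≥ 1`.  Place a minimiser of the `M`-problem so that its lowest particle (first coordinate) sits at height exactly `1` above the highest
particle of a minimiser of the `K`-problem: every cross distance is `≥ 1` (`V_LJ ≤ 0`) and the docked pair is at distance `1` (`V_LJ = −1/12`). -/
theorem groundStateEnergy_add_le (K M : ℕ) (hK : 0 < K) (hM : 0 < M) :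
    groundStateEnergy lennardJones 3 (K + M) ≤
      groundStateEnergy lennardJones 3 K + groundStateEnergy lennardJones 3 M - 1 / 12 := by
  obtain ⟨y, hy⟩ := exists_isGroundState_lennardJones (d := 3) (by norm_num) K
  obtain ⟨z, hz⟩ := exists_isGroundState_lennardJones (d := 3) (by norm_num) M
  obtain ⟨i₀, -, hi₀⟩ := Finset.exists_max_image Finset.univ (fun i : Fin K => y i 0) ⟨⟨0, hK⟩, Finset.mem_univ _⟩
  obtain ⟨j₀, -, hj₀⟩ := Finset.exists_min_image Finset.univ (fun j : Fin M => z j 0) ⟨⟨0, hM⟩, Finset.mem_univ _⟩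
  set u : E3 := EuclideanSpace.single 0 1 with hu
  set c : E3 := y i₀ - z j₀ + u with hc
  set z' : Fin M → E3 := fun j => z j + c with hz'
  have hcoord : ∀ (i : Fin K) (j : Fin M), 1 ≤ (z' j - y i) 0 := by
    intro i j
    have h1 := hi₀ i (Finset.mem_univ _)
    have h2 := hj₀ j (Finset.mem_univ _)
    have : (z' j - y i) 0 = z j 0 + (y i₀ 0 - z j₀ 0 + 1) - y i 0 := by
      simp [hz', hc, hu, PiLp.add_apply, PiLp.sub_apply]
    rw [this]
    linarith
  have hfar : ∀ (i : Fin K) (j : Fin M), 1 ≤ dist (y i) (z' j) := by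
    intro i j
    rw [dist_comm, dist_eq_norm]
    have h := PiLp.norm_apply_le (z' j - y i) 0
    rw [Real.norm_eq_abs] at h
    exact le_trans (le_trans (hcoord i j) (le_abs_self _)) h
  have htouch : dist (y i₀) (z' j₀) = 1 := by
    rw [dist_comm, dist_eq_norm]
    have : z' j₀ - y i₀ = u := by
      simp only [hz', hc]
      abel
    rw [this, hu]
    simp
  have hne : ∀ (i : Fin K) (j : Fin M), y i ≠ z' j := by
    intro i j h
    have h' := hfar i j
    rw [h, dist_self] at h'
    norm_num at h'
  have hz'inj : Function.Injective z' := fun a b hab => hz.1 (add_right_cancel hab)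
  have hinj : Function.Injective (Fin.append y z') := Fin.append_injective_iff.2 ⟨hy.1, hz'inj, hne⟩
  have hle := groundStateEnergy_lennardJones_le hinj
  have hdec := interactionEnergy_append lennardJones lennardJones_zero y z'
  have hz'E : interactionEnergy lennardJones z' = interactionEnergy lennardJones z :=
    interactionEnergy_add_const lennardJones z c
  -- the cross sum: every term `≤ 0`, the docked pair contributes `−1/12`
  have hterm : ∀ (i : Fin K) (j : Fin M), lennardJones (dist (y i) (z' j)) ≤ 0 :=
    fun i j => lennardJones_nonpos (hfar i j)
  have hrow : ∀ i : Fin K, ∑ j : Fin M, lennardJones (dist (y i) (z' j)) ≤ 0 :=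
    fun i => Finset.sum_nonpos fun j _ => hterm i j
  have hrow₀ : ∑ j : Fin M, lennardJones (dist (y i₀) (z' j)) ≤ -1 / 12 := by
    rw [← Finset.add_sum_erase Finset.univ _ (Finset.mem_univ j₀), htouch, lennardJones_one]
    have : ∑ j ∈ Finset.univ.erase j₀, lennardJones (dist (y i₀) (z' j)) ≤ 0 :=
      Finset.sum_nonpos fun j _ => hterm i₀ j
    linarith
  have hcross : ∑ i : Fin K, ∑ j : Fin M, lennardJones (dist (y i) (z' j)) ≤ -1 / 12 := by
    rw [← Finset.add_sum_erase Finset.univ _ (Finset.mem_univ i₀)]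
    have : ∑ i ∈ Finset.univ.erase i₀, ∑ j : Fin M, lennardJones (dist (y i) (z' j)) ≤ 0 :=
      Finset.sum_nonpos fun i _ => hrow i
    linarith
  rw [hdec, hz'E, hy.2, hz.2] at hle
  linarith

/-- **The limit level is below every `E(n)/n` (Literature's Fekete half of the thermodynamic limit, by name `BlancLewin2015_8_holds`):**
if `E(N)/N → e` then `e·n ≤ E(n)` for every `n ≥ 1`. -/
theorem level_mul_le_groundStateEnergy {e : ℝ}
    (he : Tendsto (fun N : ℕ => groundStateEnergy lennardJones 3 N / N) atTop (𝓝 e)) {n : ℕ} (hn : 0 < n) :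
    e * n ≤ groundStateEnergy lennardJones 3 n := by
  obtain ⟨e', -, he', hle⟩ := BlancLewin2015_8_holds 3 (by norm_num) (by norm_num)
  have hee' : e = e' := tendsto_nhds_unique he he'
  subst hee'
  have h := hle n hn
  have hn' : (0 : ℝ) < n := by exact_mod_cast hn
  rwa [le_div_iff₀ hn'] at h

/-- **SURFACE FLOOR, first rung (PROVED, GS-free):** `e·k + 1/24 ≤ E(k)` for every `k ≥ 1` and every limit level `e`
(dock two `k`-minimisers: `2e·k ≤ E(2k) ≤ 2E(k) − 1/12`). -/
theorem surfaceFloor_half {e : ℝ} (he : Tendsto (fun N : ℕ => groundStateEnergy lennardJones 3 N / N) atTop (𝓝 e))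
    {k : ℕ} (hk : 0 < k) : e * k + 1 / 24 ≤ groundStateEnergy lennardJones 3 k := by
  have h2 := groundStateEnergy_add_le k k hk hk
  have hl := level_mul_le_groundStateEnergy he (n := k + k) (by omega)
  have hcast : e * ((k + k : ℕ) : ℝ) = 2 * (e * k) := by push_cast; ring
  rw [hcast] at hl
  linarith

/-- Docking `n` copies: `E(n·k) ≤ n·E(k) − (n − 1)/12` for `n, k ≥ 1`. -/
theorem groundStateEnergy_mul_le (k : ℕ) (hk : 0 < k) :
    ∀ n : ℕ, 1 ≤ n → groundStateEnergy lennardJones 3 (n * k) ≤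
      n * groundStateEnergy lennardJones 3 k - ((n : ℝ) - 1) / 12 := by
  intro n hn
  induction n, hn using Nat.le_induction with
  | base => simp
  | succ n hn ih =>
    have hnk : 0 < n * k := Nat.mul_pos (by omega) hk
    have h := groundStateEnergy_add_le (n * k) k hnk hk
    have heq : (n + 1) * k = n * k + k := by ring
    rw [heq]
    push_cast
    linarith

/-- **SURFACE FLOOR (PROVED, GS-free):** `e·k + 1/12 ≤ E(k)` for every `k ≥ 1` and every limit level `e` — a finite cluster misses at least
one full bond of the bulk energy per particle budget (`e·nk ≤ E(nk) ≤ n·E(k) − (n−1)/12` for every `n`). -/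
theorem surfaceFloor {e : ℝ} (he : Tendsto (fun N : ℕ => groundStateEnergy lennardJones 3 N / N) atTop (𝓝 e))
    {k : ℕ} (hk : 0 < k) : e * k + 1 / 12 ≤ groundStateEnergy lennardJones 3 k := by
  by_contra hlt
  push Not at hlt
  -- the deficit `δ := E(k) − e·k < 1/12`; pick `n` with `1/(12 n) < 1/12 − δ`
  set δ := groundStateEnergy lennardJones 3 k - e * k with hδ
  have hgap : 0 < 1 / 12 - δ := by linarith
  obtain ⟨n₀, hn₀⟩ := exists_nat_gt (1 / (12 * (1 / 12 - δ)))
  set n : ℕ := n₀ + 1 with hn_def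
  have hn1 : 1 ≤ n := by omega
  have hn : 1 / (12 * (1 / 12 - δ)) < (n : ℝ) := by
    have : (n : ℝ) = n₀ + 1 := by rw [hn_def]; push_cast; ring
    rw [this]
    linarith
  have hn' : (0 : ℝ) < n := by exact_mod_cast (show 0 < n by omega)
  have hdock := groundStateEnergy_mul_le k hk n hn1
  have hl := level_mul_le_groundStateEnergy he (n := n * k) (Nat.mul_pos (by omega) hk)
  have hcast : e * ((n * k : ℕ) : ℝ) = n * (e * k) := by push_cast; ring
  rw [hcast] at hl
  -- `n (e k) ≤ n E(k) − (n−1)/12`, i.e. `(n − 1)/12 ≤ n δ`, i.e. `1/12 − δ ≤ 1/(12 n)`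
  have h1 : ((n : ℝ) - 1) / 12 ≤ n * δ := by rw [hδ]; linarith
  have h2 : (1 / 12 - δ) * n ≤ 1 / 12 := by linarith
  have h3 : 1 < (1 / 12 - δ) * (12 * n) := by
    have := (div_lt_iff₀ (by positivity : (0 : ℝ) < 12 * (1 / 12 - δ))).1 hn
    linarith
  linarith

/-! ## §2 The two laws: the loosest particle calibrates the reservoir -/

/-- **★ CALIBRATED VOID LAW (PROVED, GS-free, level-free).**  At an `(e, ε, j)`-μ-stable injective configuration (ANY level `e`), for every
particle `m` and every injective hole family `q : Fin k → E3` off the particles with `1 ≤ k ≤ j`: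
`−(𝓔(q) + Σ_i Σ_l V(|q_i − y_l|)) ≤ k·(ε − 𝓔^m(y)) + ε` — no void is fillable at a per-particle gain exceeding the binding of the loosest particle. -/
theorem fillGain_le_of_muStable {e ε : ℝ} {j : ℕ} {y : Fin N → E3}
    (hM : ∀ M : ℕ, N ≤ M + j → M ≤ N + j → ∀ z : Fin M → E3, Function.Injective z →
      interactionEnergy lennardJones y + e * ((M : ℝ) - N) - ε ≤ interactionEnergy lennardJones z)
    (hy : Function.Injective y) {k : ℕ} (hk : 1 ≤ k) (hkj : k ≤ j) {q : Fin k → E3} (hq : Function.Injective q)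
    (hdisj : ∀ (i : Fin k) (m : Fin N), q i ≠ y m) (m : Fin N) :
    -(interactionEnergy lennardJones q + ∑ i : Fin k, ∑ l : Fin N, lennardJones (dist (q i) (y l))) ≤
      k * (ε - siteEnergy lennardJones y m) + ε := by
  -- removal of `m` (order one)
  have hsite := (kinkBalanced_of_muStable hM (le_trans hk hkj) hy).1 m
  -- insertion of the holes (order `k`)
  have hinj : Function.Injective (Fin.append q y) := Fin.append_injective_iff.2 ⟨hq, hy, hdisj⟩
  have hval := hM (k + N) (by omega) (by omega) (Fin.append q y) hinj
  have hcast : e * (((k + N : ℕ) : ℝ) - (N : ℝ)) = e * k := by push_cast; ring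
  rw [hcast, interactionEnergy_append lennardJones lennardJones_zero q y] at hval
  have hk' : (0 : ℝ) ≤ k := by positivity
  have hek : -(e * k) ≤ k * (ε - siteEnergy lennardJones y m) := by
    have := mul_le_mul_of_nonneg_left (show -e ≤ ε - siteEnergy lennardJones y m by linarith) hk'
    linarith
  linarith

/-- The site energy of a filled hole in `q ⧺ y`: its bonds to the other holes plus its bonds to the particles. -/
theorem siteEnergy_append_castAdd {k : ℕ} (q : Fin k → E3) (y : Fin N → E3) (i : Fin k) :
    siteEnergy lennardJones (Fin.append q y) (Fin.castAdd N i) =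
      siteEnergy lennardJones q i + ∑ l : Fin N, lennardJones (dist (q i) (y l)) := by
  unfold siteEnergy
  rw [Finset.sum_erase (Finset.univ : Finset (Fin (k + N)))
        (f := fun l => lennardJones (dist (Fin.append q y (Fin.castAdd N i)) (Fin.append q y l)))
        (by simp [lennardJones_zero]),
      Finset.sum_erase (Finset.univ : Finset (Fin k)) (f := fun l => lennardJones (dist (q i) (q l)))
        (by simp [lennardJones_zero])]
  rw [Fin.sum_univ_add]
  simp [Fin.append_left, Fin.append_right]

/-- The filled sites together: `Σ_i 𝓔^{q_i}(q ⧺ y) = 2·𝓔(q) + Σ_i Σ_l V(|q_i − y_l|)`. -/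
theorem sum_siteEnergy_append_castAdd {k : ℕ} (q : Fin k → E3) (y : Fin N → E3) :
    ∑ i : Fin k, siteEnergy lennardJones (Fin.append q y) (Fin.castAdd N i) =
      2 * interactionEnergy lennardJones q + ∑ i : Fin k, ∑ l : Fin N, lennardJones (dist (q i) (y l)) := by
  simp only [siteEnergy_append_castAdd, Finset.sum_add_distrib]
  rw [two_mul_interactionEnergy]

/-- **★★ THE FILLED SITES BIND AT MOST TWICE THE LOOSEST PARTICLE (PROVED, GS-free; uses the surface floor, hence a LIMIT level `e`).**
At an `(e, ε, j)`-μ-stable injective `y` with `E(N)/N → e`, for every particle `m` and hole family `q` (`1 ≤ k ≤ j`):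
`k·(2𝓔^m(y) − 2ε) + (1/12 − ε) ≤ Σ_i 𝓔^{q_i}(q ⧺ y)`. -/
theorem filledSites_ge_of_muStable {e ε : ℝ} {j : ℕ} {y : Fin N → E3}
    (he : Tendsto (fun N : ℕ => groundStateEnergy lennardJones 3 N / N) atTop (𝓝 e))
    (hM : ∀ M : ℕ, N ≤ M + j → M ≤ N + j → ∀ z : Fin M → E3, Function.Injective z →
      interactionEnergy lennardJones y + e * ((M : ℝ) - N) - ε ≤ interactionEnergy lennardJones z)
    (hy : Function.Injective y) {k : ℕ} (hk : 1 ≤ k) (hkj : k ≤ j) {q : Fin k → E3} (hq : Function.Injective q)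
    (hdisj : ∀ (i : Fin k) (m : Fin N), q i ≠ y m) (m : Fin N) :
    k * (2 * siteEnergy lennardJones y m - 2 * ε) + (1 / 12 - ε) ≤
      ∑ i : Fin k, siteEnergy lennardJones (Fin.append q y) (Fin.castAdd N i) := by
  have hsite := (kinkBalanced_of_muStable hM (le_trans hk hkj) hy).1 m
  have hinj : Function.Injective (Fin.append q y) := Fin.append_injective_iff.2 ⟨hq, hy, hdisj⟩
  have hval := hM (k + N) (by omega) (by omega) (Fin.append q y) hinj
  have hcast : e * (((k + N : ℕ) : ℝ) - (N : ℝ)) = e * k := by push_cast; ring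
  rw [hcast, interactionEnergy_append lennardJones lennardJones_zero q y] at hval
  -- the holes alone are a `k`-configuration: `e k + 1/12 ≤ E(k) ≤ 𝓔(q)`
  have hfloor := surfaceFloor he (k := k) (by omega)
  have hEq := groundStateEnergy_lennardJones_le hq
  rw [sum_siteEnergy_append_castAdd]
  have hk' : (0 : ℝ) ≤ k := by positivity
  have hek : k * (2 * siteEnergy lennardJones y m - 2 * ε) ≤ 2 * (e * k) := by
    have := mul_le_mul_of_nonneg_left (show 2 * siteEnergy lennardJones y m - 2 * ε ≤ 2 * e by linarith) hk'
    linarith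
  linarith

/-! ## §2b The same law for GROUND STATES from the energy staircase alone (no `e`, no `ε`) -/

/-- **Multi-particle insertion increment (PROVED):** at a ground state `y` on `N` particles, every injective hole family `q : Fin k → E3` off the
particles has `fillGain(q, y) ≤ E(N) − E(k + N)` (the filled configuration is an admissible `(k + N)`-configuration). -/
theorem fillGain_le_increments {y : Fin N → E3} (hy : IsGroundState lennardJones y) {k : ℕ} {q : Fin k → E3}
    (hq : Function.Injective q) (hdisj : ∀ (i : Fin k) (m : Fin N), q i ≠ y m) :
    -(interactionEnergy lennardJones q + ∑ i : Fin k, ∑ l : Fin N, lennardJones (dist (q i) (y l))) ≤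
      groundStateEnergy lennardJones 3 N - groundStateEnergy lennardJones 3 (k + N) := by
  have hinj : Function.Injective (Fin.append q y) := Fin.append_injective_iff.2 ⟨hq, hy.1, hdisj⟩
  have hle := groundStateEnergy_lennardJones_le hinj
  rw [interactionEnergy_append lennardJones lennardJones_zero q y, hy.2] at hle
  linarith

/-- **★ for GROUND STATES from the STAIRCASE (PROVED):** if some particle `m` of the ground state `y` binds by at least `|Δ|` (`𝓔^m(y) ≤ Δ`;
e.g. `Δ = E(N) − E(N−1)` by the landed `GrandCanonicalSelectionKosselPointwise.siteEnergy_le_increment`, or `Δ = e + ε` under μ-stability) and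
the energy staircase has `k`-step support `k·Δ − δ ≤ E(k + N) − E(N)` above `N`, then EVERY hole family obeys the calibrated law with tolerance
`δ`: `fillGain(q, y) ≤ δ − k·𝓔^m(y)`.  The ONLY input beyond minimality is the `k`-step concavity excess `δ_N(k) := k·Δ_N − (E(N+k) − E(N))` of
the number sequence `E(·)`. -/
theorem fillGain_le_of_staircase {y : Fin N → E3} (hy : IsGroundState lennardJones y) {k : ℕ} {q : Fin k → E3}
    (hq : Function.Injective q) (hdisj : ∀ (i : Fin k) (m : Fin N), q i ≠ y m) (m : Fin N) {Δ δ : ℝ}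
    (hΔ : siteEnergy lennardJones y m ≤ Δ)
    (hstair : k * Δ - δ ≤ groundStateEnergy lennardJones 3 (k + N) - groundStateEnergy lennardJones 3 N) :
    -(interactionEnergy lennardJones q + ∑ i : Fin k, ∑ l : Fin N, lennardJones (dist (q i) (y l))) ≤
      δ - k * siteEnergy lennardJones y m := by
  have h := fillGain_le_increments hy hq hdisj
  have hk : (0 : ℝ) ≤ k := by positivity
  have hmono : (k : ℝ) * siteEnergy lennardJones y m ≤ k * Δ := mul_le_mul_of_nonneg_left hΔ hk
  linarith

end Summit.AtomisticToContinuum.Crystallization.Theorems.LoopTunnelDialCalibratorRung
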